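import Literature.NumberTheory.Automorphic.CartanDecompositionGLnPowers
import Literature.Analysis.TotalPositivity.MultiplyPositiveProofs
import HarnessLib

/-!
# Valuations of minors on the double cosets `GL_n(𝒪) ϖ^λ GL_n(𝒪)` and bordered matrices

Topic `NumberTheory/Automorphic`; theorems only (no named fact), first file of the proof of the
direction "unitary Satake parameters ⇒ tempered" of the named fact
`Literature.NumberTheory.Automorphic.isTempered_iff_forall_norm_eq_one` (`SatakeParametersGL`;
Macdonald (1971), Cartier (1979) §IV, Getz–Hahn (2024) Exercise 8.11).  Setting: a field `F` with
a valuation (`ValuativeRel F`), `K = GL_n(𝒪) = glInt n F`, `ϖ^λ = piPow ϖ λ = diag(ϖ^{λ_i})`.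

* The crude Cauchy–Binet expansion `det (A B) = ∑_p (∏ B_{p(i) i}) det A[·, p]` over all column
  selections `p : Fin k → Fin n` is the tree's `Literature.Analysis.TotalPositivity.det_mul_eq_sum_pi`
  (`MultiplyPositiveProofs`), reused here.
* `minorBounded n k t` (a *set* of matrices, no named fact): the `n × n` matrices all of whose
  `k × k` minors with injective column selection have valuation `≤ t`.  It is stable under left
  and right multiplication by integral matrices (`mul_mem_minorBounded`,
  `mem_minorBounded_mul`), and `ϖ^λ ∈ minorBounded n k (|ϖ|^{s_k(λ)})` with `s_k(λ)` the sum of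
  the `k` smallest exponents (`tailSum`, for `λ` antitone; `piPow_mem_minorBounded`).  Hence
  (**the easy half of the theory of elementary divisors**) every `k × k` minor of an element of
  `K ϖ^λ K` has valuation `≤ |ϖ|^{s_k(λ)}` (`valuation_det_submatrix_le_of_eq_mul_piPowGL_mul`).
* `cornerExt A x d = [[A, x], [0, d]]`, the bordered `(n+1) × (n+1)` matrix, with its algebra
  (`cornerExt_mul`, `det_cornerExt`) and the two families of minors of `[[diag d, x], [0, e]]`
  used by the counting recursion of `SatakeParametersGLXiRecursion`
  (`submatrix_cornerExt_diagonal_tail`, `submatrix_cornerExt_diagonal_border`): a tail of the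
  diagonal, and a tail of the diagonal bordered by the column `x`, whose determinant is
  `x_{t₀} ∏ d_{g(j)}`.

## References

* I. G. Macdonald, *Symmetric functions and Hall polynomials*, 2nd ed. (1995), Ch. II §1
  (elementary divisors over a discrete valuation ring), Ch. V §2 [Macdonald1995].
* P. Cartier, *Representations of 𝔭-adic groups: a survey*, Proc. Sympos. Pure Math. 33 (1979),
  part 1, §IV.2 [CartierCorvallis1979].
-/

noncomputable section

open scoped MatrixGroups
open ValuativeRel Matrix Finset Literature.NumberTheory.Automorphic.Echelon

namespace Literature.NumberTheory.Automorphic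

/-! ### Vanishing of minors with a repeated column -/

section Expansion

variable {R : Type*} [CommRing R]

/-- A column selection with a repetition gives two equal columns, hence determinant `0` (any row
selection). [folklore] -/
theorem det_submatrix_eq_zero_of_not_injective_cols {k : ℕ} {ι κ : Type*} (A : Matrix κ ι R)
    (r : Fin k → κ) {p : Fin k → ι} (hp : ¬ Function.Injective p) :
    (A.submatrix r p).det = 0 := by
  unfold Function.Injective at hp
  push Not at hp
  obtain ⟨i, j, hij, hne⟩ := hp
  exact det_zero_of_column_eq hne fun l => by simp [hij]

end Expansion

/-! ### Matrices with bounded minors -/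

section Minors

variable {F : Type*} [Field F] [ValuativeRel F] {n : ℕ}

/-- The set of `n × n` matrices over `F` all of whose `k × k` minors `det M[r, c]` with an
injective column selection `c` (and any row selection `r`) have valuation `≤ t`. [folklore] -/
def minorBounded (n k : ℕ) (t : ValueGroupWithZero F) : Set (Matrix (Fin n) (Fin n) F) :=
  {M | ∀ (r c : Fin k → Fin n), Function.Injective c →
    valuation F (M.submatrix r c).det ≤ t}

/-- Membership in `minorBounded`. [folklore] -/
theorem mem_minorBounded_iff {k : ℕ} {t : ValueGroupWithZero F} {M : Matrix (Fin n) (Fin n) F} :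
    M ∈ minorBounded n k t ↔ ∀ (r c : Fin k → Fin n), Function.Injective c →
      valuation F (M.submatrix r c).det ≤ t :=
  Iff.rfl

/-- In `minorBounded` the row selection may have repetitions too: then the minor vanishes.
[folklore] -/
theorem valuation_det_submatrix_le_of_mem_minorBounded {k : ℕ} {t : ValueGroupWithZero F}
    {M : Matrix (Fin n) (Fin n) F} (hM : M ∈ minorBounded n k t) (r c : Fin k → Fin n)
    (hc : Function.Injective c) : valuation F (M.submatrix r c).det ≤ t :=
  hM r c hc

/-- A product of integral entries has valuation `≤ 1`. [folklore] -/
theorem valuation_prod_le_one {ι : Type*} (s : Finset ι) {f : ι → F}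
    (hf : ∀ i ∈ s, f i ∈ 𝒪[F]) : valuation F (∏ i ∈ s, f i) ≤ 1 := by
  classical
  induction s using Finset.induction_on with
  | empty => simp
  | insert a s ha ih =>
    rw [Finset.prod_insert ha, map_mul]
    have h1 : valuation F (f a) ≤ 1 :=
      (Valuation.mem_integer_iff _ _).1 (hf a (Finset.mem_insert_self a s))
    have h2 := ih fun i hi => hf i (Finset.mem_insert_of_mem hi)
    calc valuation F (f a) * valuation F (∏ i ∈ s, f i) ≤ 1 * 1 :=
          mul_le_mul' h1 h2
      _ = 1 := one_mul 1

/-- **Right multiplication by an integral matrix preserves the minor bounds**: the columns of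
`M N` are `𝒪`-combinations of the columns of `M`, and the determinant is multilinear in the
columns. [folklore] -/
theorem mul_mem_minorBounded {k : ℕ} {t : ValueGroupWithZero F} {M N : Matrix (Fin n) (Fin n) F}
    (hM : M ∈ minorBounded n k t) (hN : IsIntegralMatrix N) : M * N ∈ minorBounded n k t := by
  classical
  intro r c hc
  rw [Matrix.submatrix_mul M N r id c Function.bijective_id,
    Literature.Analysis.TotalPositivity.det_mul_eq_sum_pi]
  refine Valuation.map_sum_le _ fun p _ => ?_
  rw [map_mul]
  have h1 : valuation F (∏ i, (N.submatrix id c) (p i) i) ≤ 1 :=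
    valuation_prod_le_one _ fun i _ => hN (p i) (c i)
  have h2 : valuation F ((M.submatrix r id).submatrix id p).det ≤ t := by
    rw [Matrix.submatrix_submatrix, Function.comp_id, Function.id_comp]
    by_cases hp : Function.Injective p
    · exact hM r p hp
    · rw [det_submatrix_eq_zero_of_not_injective_cols M r hp, map_zero]
      exact zero_le
  calc valuation F (∏ i, (N.submatrix id c) (p i) i) *
        valuation F ((M.submatrix r id).submatrix id p).det ≤ 1 * t := mul_le_mul' h1 h2
    _ = t := one_mul t

/-- **Left multiplication by an integral matrix preserves the minor bounds** (rows are
`𝒪`-combinations of rows; transpose of `mul_mem_minorBounded`). [folklore] -/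
theorem mem_minorBounded_mul {k : ℕ} {t : ValueGroupWithZero F} {M N : Matrix (Fin n) (Fin n) F}
    (hN : IsIntegralMatrix N) (hM : M ∈ minorBounded n k t) : N * M ∈ minorBounded n k t := by
  classical
  intro r c hc
  rw [← Matrix.det_transpose, Matrix.transpose_submatrix, Matrix.transpose_mul,
    Matrix.submatrix_mul _ _ c id r Function.bijective_id,
    Literature.Analysis.TotalPositivity.det_mul_eq_sum_pi]
  refine Valuation.map_sum_le _ fun p _ => ?_
  rw [map_mul]
  have h1 : valuation F (∏ i, (N.transpose.submatrix id r) (p i) i) ≤ 1 :=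
    valuation_prod_le_one _ fun i _ => hN (r i) (p i)
  have h2 : valuation F ((M.transpose.submatrix c id).submatrix id p).det ≤ t := by
    rw [Matrix.submatrix_submatrix, Function.comp_id, Function.id_comp,
      ← Matrix.transpose_submatrix, Matrix.det_transpose]
    exact hM p c hc
  calc valuation F (∏ i, (N.transpose.submatrix id r) (p i) i) *
        valuation F ((M.transpose.submatrix c id).submatrix id p).det ≤ 1 * t :=
          mul_le_mul' h1 h2
    _ = t := one_mul t

/-! ### The sum of the `k` smallest exponents -/

/-- `s_k(a) = ∑_{i ≥ n - k} a_i`: for an antitone `a : Fin n → ℕ` the sum of its `k` smallest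
values (all of them if `k ≥ n`). [folklore] -/
def tailSum (a : Fin n → ℕ) (k : ℕ) : ℕ := ∑ i : Fin n, if n ≤ (i : ℕ) + k then a i else 0

/-- `tailSum` as a sum over the filter `{i | n ≤ i + k}`. [folklore] -/
theorem tailSum_eq_sum_filter (a : Fin n → ℕ) (k : ℕ) :
    tailSum a k = ∑ i ∈ (univ : Finset (Fin n)).filter (fun i : Fin n => n ≤ (i : ℕ) + k), a i := by
  rw [tailSum, Finset.sum_filter]

/-- **The `k` smallest values have the smallest sum**: for `a` antitone and an injective
selection `c : Fin k → Fin n`, `s_k(a) ≤ ∑_i a_{c(i)}`. [folklore] -/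
theorem tailSum_le_sum_of_injective {a : Fin n → ℕ} (ha : Antitone a) {k : ℕ} {c : Fin k → Fin n}
    (hc : Function.Injective c) : tailSum a k ≤ ∑ i, a (c i) := by
  classical
  set S : Finset (Fin n) := univ.image c with hS
  set T : Finset (Fin n) := univ.filter (fun i : Fin n => n ≤ (i : ℕ) + k) with hT
  have hsumS : ∑ i, a (c i) = ∑ j ∈ S, a j := by
    rw [hS, Finset.sum_image fun x _ y _ h => hc h]
  rw [hsumS, tailSum_eq_sum_filter, ← hT]
  have hk : k ≤ n := by simpa using Fintype.card_le_of_injective c hc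
  have hcardS : S.card = k := by
    rw [hS, Finset.card_image_of_injective _ hc, card_univ, Fintype.card_fin]
  have hcardT : T.card = k := by
    -- `T` is the image of `j ↦ n - k + j`
    have hT' : T = univ.image (fun j : Fin k => (⟨n - k + j, by omega⟩ : Fin n)) := by
      ext i
      simp only [hT, Finset.mem_filter, Finset.mem_univ, true_and, Finset.mem_image]
      constructor
      · intro hi
        exact ⟨⟨i - (n - k), by omega⟩, Fin.ext (by simp; omega)⟩
      · rintro ⟨j, rfl⟩
        simp
        omega
    rw [hT', Finset.card_image_of_injective, card_univ, Fintype.card_fin]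
    intro j j' h
    simp only [Fin.mk.injEq] at h
    exact Fin.ext (by omega)
  -- split both sums along `S ∩ T`
  have h1 : ∑ j ∈ T, a j = ∑ j ∈ T \ S, a j + ∑ j ∈ T ∩ S, a j := by
    rw [← Finset.sum_sdiff (Finset.inter_subset_left : T ∩ S ⊆ T), Finset.sdiff_inter_self_left]
  have h2 : ∑ j ∈ S, a j = ∑ j ∈ S \ T, a j + ∑ j ∈ S ∩ T, a j := by
    rw [← Finset.sum_sdiff (Finset.inter_subset_left : S ∩ T ⊆ S), Finset.sdiff_inter_self_left]
  rw [h1, h2, Finset.inter_comm T S]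
  refine Nat.add_le_add_right ?_ _
  -- the two difference sets have the same cardinality
  have hcard : (T \ S).card = (S \ T).card := by
    have e1 := Finset.card_sdiff_add_card_inter T S
    have e2 := Finset.card_sdiff_add_card_inter S T
    rw [Finset.inter_comm S T] at e2
    omega
  rcases (S \ T).eq_empty_or_nonempty with he | hne
  · rw [he, Finset.card_empty, Finset.card_eq_zero] at hcard
    rw [hcard, he]
  · -- a threshold index `i₀ = n - k` exists
    obtain ⟨j₀, hj₀⟩ := hne
    have hj₀' : (j₀ : ℕ) + k < n := by
      have := (Finset.mem_sdiff.1 hj₀).2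
      simp only [hT, Finset.mem_filter, Finset.mem_univ, true_and, not_le] at this
      exact this
    have hk0 : 0 < k := by
      rw [← hcardS]
      exact Finset.card_pos.2 ⟨j₀, (Finset.mem_sdiff.1 hj₀).1⟩
    set i₀ : Fin n := ⟨n - k, by omega⟩ with hi₀
    calc ∑ j ∈ T \ S, a j ≤ (T \ S).card • a i₀ := by
          refine Finset.sum_le_card_nsmul _ _ _ fun i hi => ha ?_
          have := (Finset.mem_sdiff.1 hi).1
          simp only [hT, Finset.mem_filter, Finset.mem_univ, true_and] at this
          change (n - k : ℕ) ≤ (i : ℕ)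
          omega
      _ = (S \ T).card • a i₀ := by rw [hcard]
      _ ≤ ∑ j ∈ S \ T, a j := by
          refine Finset.card_nsmul_le_sum _ _ _ fun j hj => ha ?_
          have := (Finset.mem_sdiff.1 hj).2
          simp only [hT, Finset.mem_filter, Finset.mem_univ, true_and, not_le] at this
          change (j : ℕ) ≤ (n - k : ℕ)
          omega

/-- **The minors of `ϖ^a`**: for `a` antitone and `|ϖ| ≤ 1`, every `k × k` minor of
`diag(ϖ^{a_i})` with injective column selection has valuation `≤ |ϖ|^{s_k(a)}` (it is `0` or
`± ∏_i ϖ^{a_{c(i)}}`). [folklore] -/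
theorem piPow_mem_minorBounded {ϖ : F} (hϖ : valuation F ϖ ≤ 1) {a : Fin n → ℕ} (ha : Antitone a)
    (k : ℕ) : piPow ϖ a ∈ minorBounded n k (valuation F ϖ ^ tailSum a k) := by
  classical
  intro r c hc
  rw [Matrix.det_apply']
  refine Valuation.map_sum_le _ fun σ _ => ?_
  have hterm : valuation F (∏ i, (piPow ϖ a).submatrix r c (σ i) i) ≤
      valuation F ϖ ^ tailSum a k := by
    rw [map_prod]
    calc ∏ i, valuation F ((piPow ϖ a).submatrix r c (σ i) i)
        ≤ ∏ i, valuation F ϖ ^ a (c i) := by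
          refine Finset.prod_le_prod' fun i _ => ?_
          rw [Matrix.submatrix_apply, piPow_apply]
          split_ifs with h
          · rw [map_pow, h]
          · rw [map_zero]; exact zero_le
      _ = valuation F ϖ ^ ∑ i, a (c i) := Finset.prod_pow_eq_pow_sum _ _ _
      _ ≤ valuation F ϖ ^ tailSum a k :=
          pow_le_pow_right_of_le_one' hϖ (tailSum_le_sum_of_injective ha hc)
  have hsign : valuation F (((Equiv.Perm.sign σ : ℤˣ) : ℤ) : F) ≤ 1 := by
    rcases Int.units_eq_one_or (Equiv.Perm.sign σ) with h | h
    · rw [h, Units.val_one, Int.cast_one, map_one]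
    · rw [h, Units.val_neg, Units.val_one, Int.cast_neg, Int.cast_one, Valuation.map_neg, map_one]
  rw [map_mul]
  calc valuation F (((Equiv.Perm.sign σ : ℤˣ) : ℤ) : F) *
      valuation F (∏ i, (piPow ϖ a).submatrix r c (σ i) i) ≤ 1 * valuation F ϖ ^ tailSum a k :=
        mul_le_mul' hsign hterm
    _ = _ := one_mul _

/-- **Minors on `K ϖ^a K`** (the easy half of the theory of elementary divisors; Macdonald
(1995), Ch. II §1): if `y = k₁ ϖ^a k₂` with `k₁, k₂ ∈ GL_n(𝒪)`, `a` antitone and `ϖ ∈ 𝒪`, then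
every `k × k` minor of `y` with injective column selection has valuation `≤ |ϖ|^{s_k(a)}`,
`s_k(a)` the sum of the `k` smallest `a_i`. [cite: Macdonald1995, Ch. II §1] -/
theorem valuation_det_submatrix_le_of_eq_mul_piPowGL_mul {ϖ : F} (hϖ0 : ϖ ≠ 0)
    (hϖ : valuation F ϖ ≤ 1) {a : Fin n → ℕ} (ha : Antitone a) {k₁ k₂ y : GL (Fin n) F}
    (hk₁ : k₁ ∈ glInt n F) (hk₂ : k₂ ∈ glInt n F) (hy : y = k₁ * piPowGL hϖ0 a * k₂) {k : ℕ}
    (r c : Fin k → Fin n) (hc : Function.Injective c) :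
    valuation F ((y : Matrix (Fin n) (Fin n) F).submatrix r c).det ≤
      valuation F ϖ ^ tailSum a k := by
  have hmem : (y : Matrix (Fin n) (Fin n) F) ∈ minorBounded n k (valuation F ϖ ^ tailSum a k) := by
    rw [hy, Units.val_mul, Units.val_mul, coe_piPowGL]
    exact mul_mem_minorBounded (mem_minorBounded_mul (isIntegralMatrix_of_mem_glInt hk₁)
      (piPow_mem_minorBounded hϖ ha k)) (isIntegralMatrix_of_mem_glInt hk₂)
  exact hmem r c hc

end Minors

/-! ### Bordered matrices `[[A, x], [0, d]]` -/

section Corner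

variable {R : Type*} [CommRing R] {n : ℕ}

/-- The **bordered matrix** `[[A, x], [0, d]]` of size `n + 1`: `A` in the upper left `n × n`
corner (indices `Fin.castSucc`), the column `x` and the entry `d` in the last column, zeros in
the rest of the last row. [folklore] -/
def cornerExt (A : Matrix (Fin n) (Fin n) R) (x : Fin n → R) (d : R) :
    Matrix (Fin (n + 1)) (Fin (n + 1)) R :=
  Matrix.of fun i j => Fin.lastCases (Fin.lastCases d (fun _ => 0) j)
    (fun i' => Fin.lastCases (x i') (fun j' => A i' j') j) i

/-- Upper left entries of `[[A, x], [0, d]]`. [folklore] -/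
@[simp]
theorem cornerExt_apply_castSucc_castSucc (A : Matrix (Fin n) (Fin n) R) (x : Fin n → R) (d : R)
    (i j : Fin n) : cornerExt A x d i.castSucc j.castSucc = A i j := by
  simp [cornerExt]

/-- Last column of `[[A, x], [0, d]]` above the corner. [folklore] -/
@[simp]
theorem cornerExt_apply_castSucc_last (A : Matrix (Fin n) (Fin n) R) (x : Fin n → R) (d : R)
    (i : Fin n) : cornerExt A x d i.castSucc (Fin.last n) = x i := by
  simp [cornerExt]

/-- Last row of `[[A, x], [0, d]]` left of the corner. [folklore] -/
@[simp]
theorem cornerExt_apply_last_castSucc (A : Matrix (Fin n) (Fin n) R) (x : Fin n → R) (d : R)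
    (j : Fin n) : cornerExt A x d (Fin.last n) j.castSucc = 0 := by
  simp [cornerExt]

/-- The corner entry of `[[A, x], [0, d]]`. [folklore] -/
@[simp]
theorem cornerExt_apply_last_last (A : Matrix (Fin n) (Fin n) R) (x : Fin n → R) (d : R) :
    cornerExt A x d (Fin.last n) (Fin.last n) = d := by
  simp [cornerExt]

/-- **Products of bordered matrices**: `[[A, x], [0, d]] [[B, y], [0, d']] = [[AB, Ay + d'x], [0, dd']]`.
[folklore] -/
theorem cornerExt_mul (A B : Matrix (Fin n) (Fin n) R) (x y : Fin n → R) (d d' : R) :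
    cornerExt A x d * cornerExt B y d' = cornerExt (A * B) (A *ᵥ y + d' • x) (d * d') := by
  ext i j
  rw [Matrix.mul_apply, Fin.sum_univ_castSucc]
  refine Fin.lastCases ?_ (fun i' => ?_) i <;> refine Fin.lastCases ?_ (fun j' => ?_) j
  · simp
  · simp
  · simp [Matrix.mulVec, dotProduct, mul_comm d']
  · simp [Matrix.mul_apply]

/-- `[[1, 0], [0, 1]] = 1`. [folklore] -/
@[simp]
theorem cornerExt_one_zero_one : cornerExt (1 : Matrix (Fin n) (Fin n) R) 0 1 = 1 := by
  ext i j
  refine Fin.lastCases ?_ (fun i' => ?_) i <;> refine Fin.lastCases ?_ (fun j' => ?_) j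
  · simp
  · simp [(Fin.castSucc_lt_last j').ne']
  · simp [(Fin.castSucc_lt_last i').ne]
  · simp [Matrix.one_apply]

/-- The upper left corner of `[[A, x], [0, d]]` is `A`. [folklore] -/
theorem submatrix_cornerExt_castSucc (A : Matrix (Fin n) (Fin n) R) (x : Fin n → R) (d : R) :
    (cornerExt A x d).submatrix Fin.castSucc Fin.castSucc = A := by
  ext i j
  simp

/-- **Determinant of a bordered matrix**: `det [[A, x], [0, d]] = d · det A` (expansion along the
last row). [folklore] -/
theorem det_cornerExt (A : Matrix (Fin n) (Fin n) R) (x : Fin n → R) (d : R) :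
    (cornerExt A x d).det = d * A.det := by
  rw [Matrix.det_succ_row _ (Fin.last n), Fin.sum_univ_castSucc]
  have h0 : ∑ j : Fin n, (-1 : R) ^ ((Fin.last n : ℕ) + (j.castSucc : ℕ)) *
      cornerExt A x d (Fin.last n) j.castSucc *
        ((cornerExt A x d).submatrix (Fin.last n).succAbove j.castSucc.succAbove).det = 0 := by
    refine Finset.sum_eq_zero fun j _ => ?_
    rw [cornerExt_apply_last_castSucc, mul_zero, zero_mul]
  rw [h0, zero_add, cornerExt_apply_last_last, Fin.succAbove_last, submatrix_cornerExt_castSucc]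
  have h1 : (-1 : R) ^ ((Fin.last n : ℕ) + (Fin.last n : ℕ)) = 1 := by
    rw [Fin.val_last, ← two_mul, pow_mul, neg_one_sq, one_pow]
  rw [h1, one_mul]

/-- A bordered matrix `[[A, x], [0, d]]` with `A` upper triangular is upper triangular.
[folklore] -/
theorem blockTriangular_cornerExt {A : Matrix (Fin n) (Fin n) R} (hA : A.BlockTriangular id)
    (x : Fin n → R) (d : R) : (cornerExt A x d).BlockTriangular id := by
  intro i j hij
  revert hij
  refine Fin.lastCases ?_ (fun i' => ?_) i <;> refine Fin.lastCases ?_ (fun j' => ?_) j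
  · intro h; exact absurd h (lt_irrefl _)
  · intro _; simp
  · intro h
    exact absurd (Fin.castSucc_lt_last i') (not_lt.2 (le_of_lt h))
  · intro h
    rw [cornerExt_apply_castSucc_castSucc]
    exact hA (by simpa using h)

/-- Diagonal entries of a bordered matrix. [folklore] -/
theorem cornerExt_apply_self (A : Matrix (Fin n) (Fin n) R) (x : Fin n → R) (d : R)
    (i : Fin (n + 1)) :
    cornerExt A x d i i = Fin.lastCases d (fun i' => A i' i') i := by
  refine Fin.lastCases ?_ (fun i' => ?_) i <;> simp

/-! ### Two families of minors of `[[diag d, x], [0, e]]` -/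

/-- **A tail of the diagonal**: for an injective `g : Fin m → Fin n`, the minor of
`[[diag d, x], [0, e]]` on the rows and columns `castSucc (g j)` is `diag (d ∘ g)`. [folklore] -/
theorem submatrix_cornerExt_diagonal_tail {m : ℕ} (d : Fin n → R) (x : Fin n → R) (e : R)
    {g : Fin m → Fin n} (hg : Function.Injective g) :
    (cornerExt (Matrix.diagonal d) x e).submatrix (Fin.castSucc ∘ g) (Fin.castSucc ∘ g) =
      Matrix.diagonal (d ∘ g) := by
  ext i j
  simp only [Matrix.submatrix_apply, Function.comp_apply, cornerExt_apply_castSucc_castSucc,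
    Matrix.diagonal_apply, hg.eq_iff]

/-- The row selection of the bordered tail minor: `castSucc (g i')` for `i' < m`, then
`castSucc t₀`. [folklore] -/
def borderRows {m : ℕ} (t₀ : Fin n) (g : Fin m → Fin n) : Fin (m + 1) → Fin (n + 1) :=
  fun i => Fin.lastCases t₀.castSucc (fun i' => (g i').castSucc) i

/-- The column selection of the bordered tail minor: `castSucc (g j')` for `j' < m`, then `last`.
[folklore] -/
def borderCols {m : ℕ} (g : Fin m → Fin n) : Fin (m + 1) → Fin (n + 1) :=
  fun j => Fin.lastCases (Fin.last n) (fun j' => (g j').castSucc) j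

/-- The last selected row is `castSucc t₀`. [folklore] -/
@[simp]
theorem borderRows_last {m : ℕ} (t₀ : Fin n) (g : Fin m → Fin n) :
    borderRows t₀ g (Fin.last m) = t₀.castSucc := by
  simp [borderRows]

/-- The first selected rows are `castSucc (g i')`. [folklore] -/
@[simp]
theorem borderRows_castSucc {m : ℕ} (t₀ : Fin n) (g : Fin m → Fin n) (i' : Fin m) :
    borderRows t₀ g i'.castSucc = (g i').castSucc := by
  simp [borderRows]

/-- The last selected column is the last column. [folklore] -/
@[simp]
theorem borderCols_last {m : ℕ} (g : Fin m → Fin n) : borderCols g (Fin.last m) = Fin.last n := by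
  simp [borderCols]

/-- The first selected columns are `castSucc (g j')`. [folklore] -/
@[simp]
theorem borderCols_castSucc {m : ℕ} (g : Fin m → Fin n) (j' : Fin m) :
    borderCols g j'.castSucc = (g j').castSucc := by
  simp [borderCols]

/-- **A bordered tail of the diagonal**: for an injective `g : Fin m → Fin n` avoiding `t₀`, the
minor of `[[diag d, x], [0, e]]` on the rows `castSucc (g j)` (`j < m`), `castSucc t₀` and the
columns `castSucc (g j)` (`j < m`), `last` is again a bordered matrix,
`[[diag (d ∘ g), x ∘ g], [0, x t₀]]` — so its determinant is `x t₀ ∏_j d (g j)`. [folklore] -/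
theorem submatrix_cornerExt_diagonal_border {m : ℕ} (d : Fin n → R) (x : Fin n → R) (e : R)
    (t₀ : Fin n) {g : Fin m → Fin n} (hg : Function.Injective g) (ht : ∀ j, g j ≠ t₀) :
    (cornerExt (Matrix.diagonal d) x e).submatrix (borderRows t₀ g) (borderCols g) =
      cornerExt (Matrix.diagonal (d ∘ g)) (x ∘ g) (x t₀) := by
  ext i j
  refine Fin.lastCases ?_ (fun i' => ?_) i <;> refine Fin.lastCases ?_ (fun j' => ?_) j
  · simp
  · simp [(ht j').symm]
  · simp
  · simp [Matrix.diagonal_apply, hg.eq_iff]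

/-- The determinant of the bordered tail minor: `x t₀ ∏_j d (g j)`. [folklore] -/
theorem det_submatrix_cornerExt_diagonal_border {m : ℕ} (d : Fin n → R) (x : Fin n → R) (e : R)
    (t₀ : Fin n) {g : Fin m → Fin n} (hg : Function.Injective g) (ht : ∀ j, g j ≠ t₀) :
    ((cornerExt (Matrix.diagonal d) x e).submatrix (borderRows t₀ g) (borderCols g)).det =
      x t₀ * ∏ j, d (g j) := by
  rw [submatrix_cornerExt_diagonal_border d x e t₀ hg ht, det_cornerExt, Matrix.det_diagonal]
  rfl

/-- The column selection of the bordered tail minor is injective. [folklore] -/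
theorem borderCols_injective {m : ℕ} {g : Fin m → Fin n} (hg : Function.Injective g) :
    Function.Injective (borderCols g) := by
  intro i j
  induction i using Fin.lastCases with
  | last =>
    induction j using Fin.lastCases with
    | last => intro _; rfl
    | cast j' =>
      intro h
      rw [borderCols_last, borderCols_castSucc] at h
      exact absurd h.symm (Fin.castSucc_lt_last _).ne
  | cast i' =>
    induction j using Fin.lastCases with
    | last =>
      intro h
      rw [borderCols_last, borderCols_castSucc] at h
      exact absurd h (Fin.castSucc_lt_last _).ne
    | cast j' =>
      intro h
      rw [borderCols_castSucc, borderCols_castSucc, Fin.castSucc_inj] at h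
      rw [hg h]

/-- `castSucc ∘ g` is injective for `g` injective. [folklore] -/
theorem injective_castSucc_comp {m : ℕ} {g : Fin m → Fin n} (hg : Function.Injective g) :
    Function.Injective (Fin.castSucc ∘ g) :=
  (Fin.castSucc_injective n).comp hg

end Corner

end Literature.NumberTheory.Automorphic
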